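import Summits.AtomisticToContinuum.Crystallization.Theses.ThreeConeCertificate
import Summits.AtomisticToContinuum.Crystallization.Theorems.ThreeConeCertificateOnePercentCertificateReduction
import Summits.AtomisticToContinuum.Crystallization.Theorems.OnePercentCertificate.Negative.StubLocal
import Summits.AtomisticToContinuum.Crystallization.Theorems.OnePercentCertificate.Negative.StubLocalHardCore
import Literature.Barriers.AtomisticToContinuum.IcosahedralClusters
import Literature.MathematicalPhysics.StatisticalMechanics.HardCoreGSC

/-!
# Disproof of `OnePercentCertificate` — findings (cdisprove, crux stmt-AtomisticToContinuum-11958)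

Crux (route `ThreeConeCertificate`, rank 2): `∃ c g U f`, `V_LJ = g + U + f` on `(0,∞)`, `U ≥ 0`,
`g ≡ 0` on `[5/2,∞)`, `f` of positive type on `ℝ³` (all finite quadratic forms), `g` `c`-stable on finite
injective configurations, and `c + f 0 / 2 ≤ 29/40`.

Findings so far (details in the docstrings below; numbers in tree units `V_LJ = r⁻¹²/12 − r⁻⁶/6`):

* (elaboration) rc 0; no junk: `interactionEnergy` sums over `i < j` only (no `g 0` term), `lennardJones 0 = 0`
  never enters (injective configurations, `0 < r` guards), `f 0 ≥ 0` and `c ≥ 0` are forced (`n = 1`, `N = 1`).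
* (mechanism, proved) `value_lower_bound`: ANY admissible split — the range hypothesis is NOT used — satisfies
  `-(c + f 0/2)·N ≤ E_LJ(x)` for every injective `x`. Hence `OnePercentCertificate → (B_LJ ≤ 29/40)`
  (`stability_bound_of_onePercentCertificate`): the crux is at least as strong as improving the printed
  Lennard-Jones stability constant `14.316 ε` (Yuhjtman 2015, Thm 9) to `8.7 ε`; and the crux WITHOUT the range
  condition is EQUIVALENT to that stability bound (`withoutRange_iff_stability`).  Consequently a refutation
  must either exhibit a finite configuration with `E_LJ(x) < -(29/40)·N` (numerically hopeless: cluster energies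
  per particle stay above `e(hcp) = -0.71759`, and finite `N` loses `≈ 1.7 N^{-1/3}` of it) or EXPLOIT THE RANGE
  `5/2` through a non-realizable "phantom" pair measure (the LP dual, see `phantom` below).
* (load-bearing) dropping positive type, the sign of `U`, or the decomposition makes the crux trivially true
  (`withoutPosType_trivial`, `withoutSlackSign_trivial`); dropping stability leaves only "some positive-type
  `f ≤ V_LJ` on `[5/2,∞)`" (true analytically, e.g. Gaussian mixture + FT of `exp(-|k|³)`, not formalised);
  dropping the range gives `B_LJ ≤ 29/40` (open, believed true: `B_LJ = -e(hcp) = 0.7176` numerically).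
  So every hypothesis but the range is needed by any PROOF, and the range is needed by any REFUTATION.
* (strengthening refuted, proved) `not_certificateWithValue_ico`: with `29/40` replaced by `3677/13000 ≈ 0.2829`
  the statement is false at every range (icosahedral 13-cluster of the barrier file `IcosahedralClusters`).
  Informally the threshold is `-inf_N E(N)/N ≈ 0.7176` (hcp), 1.03 % below `29/40`.
* (phantom LP = the only refutation mechanism, see `withoutRange_iff_stability`) the Lagrange dual of the
  certificate LP: maximise `-∫ V dm` over radial pair measures `m ≥ 0` on `(0,∞)` whose restriction to `(0,5/2)` is
  (a limit of convex combinations of) per-particle pair statistics of finite configurations and with `δ₀/2 + m` of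
  positive type in `ℝ³` (`S(k) = 1 + 2∫ sinc(kr) dm ≥ 0`); weak duality `c + f 0/2 ≥ -∫ V dm` for every admissible
  split (rigorous for finite-mass phantoms; infinite ones are limits through Schur products with ball covariograms,
  whose local parts are exactly the expected statistics of random ball chunks).  A dual value `> 29/40` kills the
  crux (on paper; in Lean it would need the finite Farkas form: finitely many stability-test configurations and
  positive-type test pairs `(y,w)` whose off-diagonal distance measure matches the stability tests below `5/2` —
  the `N^{-1/3}` surface deficit of finite test clusters makes a 1 % Lean certificate hopeless, `N ~ 10⁶`).
  NUMERICS: kit jobs j007931/j007932/j008213 (R0 = 5/2), j008016-j008020 (R0 = 1.2 … 3.5), j008021 (pure two-point),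
  script `phantom/main.py` in the seat folder; values recorded here when they land (farm queue ≈ 4300 jobs).
* (why the crux should RESIST the phantom attack at range 5/2 — informal, to be confronted with the numerics)
  (i) budget: the hcp pair energy beyond `r = 5/2 = 2.57 a*` is only `≈ -0.034` (4.8 % of `e`), inside `5/2` it is
  `≈ -0.684`; to reach `29/40` a phantom with honest local statistics needs a tail `≥ 0.041`, i.e. `≥ 20 %` MORE pair
  mass than hcp in the zone `2.5–4` — while even the totally unconstrained packing phantom of the 3-D Cohn–Elkies LP
  cheats fcc's density by only `≈ 5 %` (Li2022 barrier file: `0.18398 < LP ≤ 0.1862` vs `0.17678`);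
  (ii) exact crystals are ISOLATED dual points: for an exact periodic `P`, `S_P = 0` off the Bragg spheres, so any
  modification supported in `r ≥ 5/2` would itself have to be of positive type, and a positive-type measure vanishing
  near `0` is `0`; hence a phantom beating `-e(hcp)` must have NON-crystalline (smeared / mixed) local statistics and
  pay for it: Einstein smearing `σ` costs `≈ 64 σ²` per particle (first shell, `V''(a*) ≈ 10.7`), dilation mixing
  `≈ 55 σ_a²`, i.e. `≈ 1 %` of `|e|` already at `σ ≈ 0.01`, which damps `S(k)` only beyond `k ≈ 70`;
  (iii) lattice × multiplier phantoms `½[δ₀ + Σ_r n_r ψ(r) δ_r]` (`ψ` positive type, `ψ(0) = 1`, the natural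
  finite-test family `w_i = cos(k·y_i)`) never beat the crystal since `|ψ| ≤ 1` and every hcp shell has `V < 0`;
  (iv) a gain therefore needs test sets `y` with essentially PERFECT close-packed statistics up to `2.57 a` (a 0.1 %
  first-shell deficit costs `5·10⁻⁴ ≈` the whole plausible tail gain) but non-Barlow pairs beyond — and full
  12-coordination with honest second shells is locally rigid (Barlow), so such `y` do not exist.
  Expected: `D*(5/2) - 0.7176 ≲ 2·10⁻³ ≪ 7.4·10⁻³`; the 1 % slack was chosen well.  If confirmed, the crux is decided
  on the PRIMAL side only (certifying `c(g)`), and near-optimal splits must nearly satisfy the three complementary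
  slackness conditions at hcp: `U ≈ 0` on `D_hcp`, `c + e_g(hcp) ≈ 0`, `½ Σ_{x ∈ hcp} f(x) = ½ρ Σ_G f̂(G)|S_G|² ≈ 0`
  (so `∫ f ≈ 0` although `f ≤ V_LJ` beyond `5/2` forces `∫_{|x|>5/2} f ≤ -0.045`): total slack budget `0.0074`.

## Gen 2 (2026-08-16, seat refuter-cdisprove-…-11958-g2-0): the crux is now ONE local constant — line `Sketch`

* (reduction, tree) `OnePercentReduction.onePercentCertificate_of_local` (p112372): the crux follows from
  `stub_local : ∀ N x, Injective x → −(cS·N) ≤ Σ_{i<j} gS(|x_i − x_j|)` for the explicit split of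
  `Theorems/ThreeConeCertificateDefs.lean` (`gS = (V_LJ − fS)·1_{r<5/2}`, `cS = 29/40 − fS 0/2 = 0.657987` exactly
  `657987/10⁶`, `StubLocal.cS_eq`).  Conversely `withoutStability_holds` (landed as `StubLocal.withoutStability`,
  p114975): decomposition, slack sign, range, positive type AND the value `29/40` hold simultaneously for this split,
  so with the gen-1 table the `c`-stability of a range-`5/2` part is the crux's ENTIRE content.  Section `LineSketch`.
* (shape of `gS`, numerics/gs.py) `gS(r) = r⁻¹²/12 − (r⁻⁶/6)·e^{−1.44r²}(1 + 1.44r² + 1.0368r⁴) − 0.21997e^{−1.69r²}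
  + 0.003e^{−0.81r²}` on `(0, 5/2)`: min `−0.09368` at `r = 0.988` (`V_LJ`: `−1/12` at `1`), `gS(√2·0.97) = −0.019`,
  `|gS| < 1.4e-3` beyond `1.8`, `+1e-5` on `[2.33, 2.5)` (jump to `0` at `5/2`): a first-two-shells potential; FK /
  icosahedral order loses the `√2` shell and the tail that feeds it in `V_LJ`.
* (kill test of `stub_local`, numerics) templates at optimal scale (numerics/lattices.py, kit j018677): hcp `−0.651259`
  (nn `0.9712`), dhcp `−0.651221`, fcc `−0.651205`, hcp c/a∈{1.60,1.62,1.64,1.66} ≥ `−0.65120`, bcc `−0.619955`,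
  A15 `−0.565220`, C15 `−0.524033`, sh `−0.4998`, sc `−0.4103`, diamond `−0.224`; variable-cell random search +
  basin hopping, m = 1…30 atoms/cell (kit j018706, 8 cores × 25 min, 80 seeds, ≈ 1500 relaxed minima; j018677 smoke
  test): EVERY run ends in a Barlow close packing — hcp `−0.651259` (even m), fcc `−0.651205` (odd m), a 6-layer
  polytype `−0.651234` (m = 9, 15); all 12-coordinated, vol/atom `0.6479`.  Margin to `−cS`: `0.006728` (1.03 %).
  NO configuration below `−cS` is known and none is expected (cf. the Barlow-only ground states of cut-off LJ,
  PartayOrtnerCsanyi2017): the stub resists as TRUE but Kepler-hard.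
* (load-bearing, landed p114975 `Negative/StubLocal.lean`) `StubLocal.false_without_injective`: with injectivity
  dropped the stub is false (`11` coincident points, `gS 0 = −fS 0 = −0.134` by `V_LJ 0 = 0`).
* (THE ONE-CENTRE STRATEGY IS DEAD, landed p114975) `StubLocal.not_hardCoreSiteBound`: the transfer-free site bound
  `Σ_{j≠i} gS(r_ij) ≥ −2cS` on `δ`-separated configurations (which sums to the stub, `StubLocal.of_hardCoreSiteBound`)
  is FALSE for every `δ ≤ 9/10` — sixteen explicit points (rational Tammes-15 shell at distance `1`, pairwise
  `≥ 0.902`): `15·gS 1 ≤ −1.395 < −2cS = −1.31597` (`StubLocal.gS_one_le : gS 1 ≤ −93/1000`, exp brackets).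
  Numerically (numerics/star/star2.py, design095.py) the relaxation value `v(δ) = min_star Σ_j gS(|y_j|)` is
  `≤ −1.398 (δ=0.90)`, `≤ −1.384 (0.95: 14 at 1.017 + second shell ≈1.48–1.7)`, `≤ −1.337` for the clean 3-radius
  design `14@51/50 + 8@79/50 + 8@17/10` at `δ = 19/20` (Lean: `StubLocal.not_hardCoreSiteBound_nineteen_twentieths`,
  tree file `Negative/StubLocalHardCore.lean`), `≤ −1.3269 (0.965)`, and `≈ −1.3085 > −2cS` at `δ = 0.97 ≈`
  nn(hcp-optimal) (`−1.3079` at `0.9712`): one-centre certification needs a hard core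
  within 2 % of the equilibrium distance, which no minimal-distance lemma can give (Yuhjtman-type: ≈ 0.7) — depth-2
  transfers / two-centre cells are mandatory (agrees with TrapCensusIdeator2, PHANTOM-GAP-j009067).
* (dual side, gen 2) for ANY finite Bochner test `(y, w)` and radial `F ≥ 0`,
  `Σ_{i≠j} |w_i w_j| F(r_ij) ≤ Σ_i w_i² · Σ_{j≠i} F(r_ij)` (`|w_i w_j| ≤ (w_i² + w_j²)/2`): in the LP dual (phantom
  `π = α` realizable on `(0,5/2)`, `π = β = Σ_t ν_t Σ_{i<j} w_i w_j δ_{r_ij}` everywhere, `Σ_t ν_t |w^t|² = 1`, value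
  `−∫V dπ ≤ c + f 0/2`) signed weights can only THIN the pair statistics of the test configurations shell by shell
  (factor in `[−1, 1]`, gen-1 (iii) for all tests, not just characters), so every unit of tail binding beyond `5/2`
  is bought from a genuine configuration together with its short pairs, which sign patterns must then cancel down to
  a realizable inside; measured gain at `R = 5/2`: `≤ 0.002` (3C_R25 `0.719486`, periodic floor `0.717596`,
  LP-RESULTS-ideator1 / RESULTS-j008498) — the `0.0074` budget sits entirely on `c(g)`.
* (crux level, why no refutation) unchanged from gen 1: a kill needs the phantom dual value `D(5/2) > 0.725`; exact
  crystals are isolated dual points (a positive-type radial measure vanishing on `B(5/2)` is `0`: test against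
  `ψ ∗ ψ̃`, `supp ψ ⊂ B(5/4)`), smeared statistics cost `≈ 64σ²` per particle against a tail gain `≈ 0.01σ²`;
  ideator-3's periodic-competitor floor at `R = 5/2` is `0.717596 ≈ |e(hcp)|` (RESULTS-j008498), i.e. the Bochner
  side is lossless at this range and the whole `0.0074` budget is available to `c(g)`.  Expected `D(5/2) − 0.7176
  ≲ 3e-3 < 7.4e-3`: the crux is very likely TRUE and its difficulty is entirely `stub_local`-type (Flyspeck scale).

Nothing here is a refutation of the crux.
-/

namespace Summit.AtomisticToContinuum.Crystallization.Cruxes.OnePercentCertificate.Disproof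

open scoped BigOperators
open Literature.MathematicalPhysics.StatisticalMechanics
open Summit.AtomisticToContinuum.Crystallization.Theses.ThreeConeCertificate (OnePercentCertificate)

local notation "E3" => EuclideanSpace ℝ (Fin 3)

/-! ## The certificate mechanism: value lower bound (range hypothesis unused) -/

section Mechanism

variable {c : ℝ} {g U f : ℝ → ℝ}

/-- Termwise splitting of the energy along `V_LJ = g + U + f` on `(0,∞)`: all pair distances of an
injective configuration are positive. [folklore] -/
theorem interactionEnergy_split
    (hdec : ∀ r : ℝ, 0 < r → lennardJones r = g r + U r + f r)
    {N : ℕ} {x : Fin N → E3} (hx : Function.Injective x) :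
    interactionEnergy lennardJones x =
      interactionEnergy g x + interactionEnergy U x + interactionEnergy f x := by
  unfold interactionEnergy
  rw [← Finset.sum_add_distrib, ← Finset.sum_add_distrib]
  refine Finset.sum_congr rfl fun i _ => ?_
  rw [← Finset.sum_add_distrib, ← Finset.sum_add_distrib]
  refine Finset.sum_congr rfl fun j hj => ?_
  exact hdec _ (dist_pos.2 (hx.ne (ne_of_lt (Finset.mem_Ioi.1 hj))))

/-- The slack cone is nonnegative termwise. [folklore] -/
theorem interactionEnergy_nonneg_of_nonneg (hU : ∀ r : ℝ, 0 < r → 0 ≤ U r)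
    {N : ℕ} {x : Fin N → E3} (hx : Function.Injective x) : 0 ≤ interactionEnergy U x := by
  unfold interactionEnergy
  exact Finset.sum_nonneg fun i _ => Finset.sum_nonneg fun j hj =>
    hU _ (dist_pos.2 (hx.ne (ne_of_lt (Finset.mem_Ioi.1 hj))))

/-- The Bochner cone tested with all weights `1` at the configuration itself:
`N f(0) + 2 Σ_{i<j} f(r_ij) ≥ 0`. [cite: Ruelle1969, §3.2 Prop. 3.2.7] -/
theorem neg_le_interactionEnergy_of_posType
    (hpos : ∀ (n : ℕ) (y : Fin n → E3) (w : Fin n → ℝ),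
      0 ≤ ∑ i, ∑ j, w i * w j * f (dist (y i) (y j)))
    {N : ℕ} (x : Fin N → E3) : -((N : ℝ) * f 0 / 2) ≤ interactionEnergy f x := by
  have h := hpos N x (fun _ => 1)
  simp only [one_mul] at h
  have h2 := two_mul_interactionEnergy_eq_sum_sum_sub f x
  linarith

/-- **Value lower bound.** For every admissible three-cone split (decomposition on `(0,∞)`, `U ≥ 0`,
`f` of positive type, `g` `c`-stable) and every injective configuration,
`-(c + f(0)/2)·N ≤ E_LJ(x)`. The range condition `g ≡ 0` on `[5/2,∞)` is not used.
[cite: Ruelle1969, §3.2 Prop. 3.2.7] -/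
theorem value_lower_bound
    (hdec : ∀ r : ℝ, 0 < r → lennardJones r = g r + U r + f r)
    (hU : ∀ r : ℝ, 0 < r → 0 ≤ U r)
    (hpos : ∀ (n : ℕ) (y : Fin n → E3) (w : Fin n → ℝ),
      0 ≤ ∑ i, ∑ j, w i * w j * f (dist (y i) (y j)))
    (hstab : ∀ (N : ℕ) (x : Fin N → E3), Function.Injective x →
      -(c * (N : ℝ)) ≤ interactionEnergy g x)
    {N : ℕ} {x : Fin N → E3} (hx : Function.Injective x) :
    -((c + f 0 / 2) * (N : ℝ)) ≤ interactionEnergy lennardJones x := by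
  rw [interactionEnergy_split hdec hx]
  have h1 := hstab N x hx
  have h2 := interactionEnergy_nonneg_of_nonneg hU hx
  have h3 := neg_le_interactionEnergy_of_posType hpos x
  linarith

/-- Every admissible split has value `> 3677/13000 ≈ 0.2829`: test the icosahedral `13`-cluster of
`IcosahedralClusters` (energy `< -3.677`). [cite: KlemanLavrentovich2003, §2.1.3] -/
theorem value_gt_ico
    (hdec : ∀ r : ℝ, 0 < r → lennardJones r = g r + U r + f r)
    (hU : ∀ r : ℝ, 0 < r → 0 ≤ U r)
    (hpos : ∀ (n : ℕ) (y : Fin n → E3) (w : Fin n → ℝ),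
      0 ≤ ∑ i, ∑ j, w i * w j * f (dist (y i) (y j)))
    (hstab : ∀ (N : ℕ) (x : Fin N → E3), Function.Injective x →
      -(c * (N : ℝ)) ≤ interactionEnergy g x) :
    (3677 / 13000 : ℝ) < c + f 0 / 2 := by
  have h := value_lower_bound hdec hU hpos hstab
    Literature.Barriers.AtomisticToContinuum.icosahedralCluster_injective
  have hE := Literature.Barriers.AtomisticToContinuum.interactionEnergy_icosahedralCluster_lt
  simp only [Nat.cast_ofNat] at h
  linarith

/-- `f 0 ≥ 0` (one point, weight `1`). [folklore] -/
theorem f_zero_nonneg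
    (hpos : ∀ (n : ℕ) (y : Fin n → E3) (w : Fin n → ℝ),
      0 ≤ ∑ i, ∑ j, w i * w j * f (dist (y i) (y j))) : 0 ≤ f 0 := by
  have h := hpos 1 (fun _ => 0) (fun _ => 1)
  simpa using h

/-- `c ≥ 0` (one particle has no pairs). [folklore] -/
theorem c_nonneg
    (hstab : ∀ (N : ℕ) (x : Fin N → E3), Function.Injective x →
      -(c * (N : ℝ)) ≤ interactionEnergy g x) : 0 ≤ c := by
  have h := hstab 1 (fun _ => 0) (Function.injective_of_subsingleton _)
  rw [interactionEnergy_of_subsingleton] at h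
  simpa using h

end Mechanism

/-! ## Consequences for the crux as filed -/

/-- `OnePercentCertificate` implies the stability bound `E_LJ(x) ≥ -(29/40)·N` for every finite
configuration of distinct points, i.e. `B_LJ ≤ 8.7 ε` (printed: `8.61 ≤ B_LJ ≤ 14.316 ε`).
[cite: Yuhjtman2015, Thm. 9] -/
theorem stability_bound_of_onePercentCertificate (h : OnePercentCertificate) :
    ∀ (N : ℕ) (x : Fin N → E3), Function.Injective x →
      -((29 / 40 : ℝ) * N) ≤ interactionEnergy lennardJones x := by
  obtain ⟨c, g, U, f, hdec, hU, _hrange, hpos, hstab, hval⟩ := h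
  intro N x hx
  have h1 := value_lower_bound hdec hU hpos hstab hx
  have h2 := mul_le_mul_of_nonneg_right hval (Nat.cast_nonneg N)
  linarith

/-- Refutation criterion by a low-energy configuration (contrapositive of the above): one injective
configuration with `E_LJ(x) < -(29/40)·N` kills the crux. Numerically none exists
(`E(N)/N > e(hcp) ≈ -0.7176 > -0.725`), so a refutation must use the range `5/2`. [folklore] -/
theorem not_onePercentCertificate_of_config {N : ℕ} {x : Fin N → E3} (hx : Function.Injective x)
    (hE : interactionEnergy lennardJones x < -((29 / 40 : ℝ) * N)) : ¬ OnePercentCertificate :=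
  fun h => (stability_bound_of_onePercentCertificate h N x hx).not_gt hE

/-! ## Natural strengthenings: the constant -/

/-- The crux with the bound `29/40` replaced by `b` (same shape otherwise). -/
def CertificateWithValue (b : ℝ) : Prop :=
  ∃ (c : ℝ) (g U f : ℝ → ℝ), (∀ r : ℝ, 0 < r → lennardJones r = g r + U r + f r) ∧
    (∀ r : ℝ, 0 < r → 0 ≤ U r) ∧ (∀ r : ℝ, 5 / 2 ≤ r → g r = 0) ∧
    (∀ (n : ℕ) (y : Fin n → E3) (w : Fin n → ℝ), 0 ≤ ∑ i, ∑ j, w i * w j * f (dist (y i) (y j))) ∧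
    (∀ (N : ℕ) (x : Fin N → E3), Function.Injective x → -(c * (N : ℝ)) ≤ interactionEnergy g x) ∧
    c + f 0 / 2 ≤ b

/-- The crux is the case `b = 29/40`. [folklore] -/
theorem onePercentCertificate_iff : OnePercentCertificate ↔ CertificateWithValue (29 / 40) := Iff.rfl

/-- Monotone in the bound. [folklore] -/
theorem certificateWithValue_mono {b b' : ℝ} (hb : b ≤ b') :
    CertificateWithValue b → CertificateWithValue b' :=
  fun ⟨c, g, U, f, h1, h2, h3, h4, h5, h6⟩ => ⟨c, g, U, f, h1, h2, h3, h4, h5, h6.trans hb⟩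

/-- **Strengthening refuted:** no three-cone certificate (of any range) has value `≤ 3677/13000`.
[cite: KlemanLavrentovich2003, §2.1.3] -/
theorem not_certificateWithValue_ico : ¬ CertificateWithValue (3677 / 13000) :=
  fun ⟨_, _, _, _, hdec, hU, _, hpos, hstab, hval⟩ => (value_gt_ico hdec hU hpos hstab).not_ge hval

/-! ## Load-bearing analysis: which hypotheses a proof / a refutation must use -/

/-- The crux without the positive-type condition on `f`. -/
def WithoutPosType : Prop :=
  ∃ (c : ℝ) (g U f : ℝ → ℝ), (∀ r : ℝ, 0 < r → lennardJones r = g r + U r + f r) ∧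
    (∀ r : ℝ, 0 < r → 0 ≤ U r) ∧ (∀ r : ℝ, 5 / 2 ≤ r → g r = 0) ∧
    (∀ (N : ℕ) (x : Fin N → E3), Function.Injective x → -(c * (N : ℝ)) ≤ interactionEnergy g x) ∧
    c + f 0 / 2 ≤ 29 / 40

/-- Trivially true: put everything into `f` (`f = V_LJ`, `f 0 = 0` by `0⁻¹ = 0`). So any proof of the
crux must use positive type. [folklore] -/
theorem withoutPosType_trivial : WithoutPosType := by
  refine ⟨0, fun _ => 0, fun _ => 0, lennardJones, fun r _ => by ring, fun _ _ => le_rfl,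
    fun _ _ => rfl, fun N x _ => ?_, ?_⟩
  · rw [interactionEnergy_zero]; simp
  · norm_num [lennardJones]

/-- The crux without the sign condition on the slack `U`. -/
def WithoutSlackSign : Prop :=
  ∃ (c : ℝ) (g U f : ℝ → ℝ), (∀ r : ℝ, 0 < r → lennardJones r = g r + U r + f r) ∧
    (∀ r : ℝ, 5 / 2 ≤ r → g r = 0) ∧
    (∀ (n : ℕ) (y : Fin n → E3) (w : Fin n → ℝ), 0 ≤ ∑ i, ∑ j, w i * w j * f (dist (y i) (y j))) ∧
    (∀ (N : ℕ) (x : Fin N → E3), Function.Injective x → -(c * (N : ℝ)) ≤ interactionEnergy g x) ∧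
    c + f 0 / 2 ≤ 29 / 40

/-- Trivially true: put everything into `U`. So any proof must use `U ≥ 0`. [folklore] -/
theorem withoutSlackSign_trivial : WithoutSlackSign := by
  refine ⟨0, fun _ => 0, lennardJones, fun _ => 0, fun r _ => by ring, fun _ _ => rfl,
    fun n y w => by simp, fun N x _ => ?_, by norm_num⟩
  rw [interactionEnergy_zero]; simp

/-- The crux without the range condition `g ≡ 0` on `[5/2,∞)`. -/
def WithoutRange : Prop :=
  ∃ (c : ℝ) (g U f : ℝ → ℝ), (∀ r : ℝ, 0 < r → lennardJones r = g r + U r + f r) ∧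
    (∀ r : ℝ, 0 < r → 0 ≤ U r) ∧
    (∀ (n : ℕ) (y : Fin n → E3) (w : Fin n → ℝ), 0 ≤ ∑ i, ∑ j, w i * w j * f (dist (y i) (y j))) ∧
    (∀ (N : ℕ) (x : Fin N → E3), Function.Injective x → -(c * (N : ℝ)) ≤ interactionEnergy g x) ∧
    c + f 0 / 2 ≤ 29 / 40

/-- **Without the range the crux is exactly the stability bound `B_LJ ≤ 29/40`** (open; believed true
with `B_LJ = -e(hcp) ≈ 0.7176`; printed `B_LJ ≤ 14.316/12`). So: any REFUTATION of the crux must use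
the range `5/2`; and the crux itself implies this bound. [cite: Yuhjtman2015, Thm. 9] -/
theorem withoutRange_iff_stability :
    WithoutRange ↔ ∀ (N : ℕ) (x : Fin N → E3), Function.Injective x →
      -((29 / 40 : ℝ) * N) ≤ interactionEnergy lennardJones x := by
  constructor
  · rintro ⟨c, g, U, f, hdec, hU, hpos, hstab, hval⟩ N x hx
    have h1 := value_lower_bound hdec hU hpos hstab hx
    have h2 := mul_le_mul_of_nonneg_right hval (Nat.cast_nonneg N)
    linarith
  · intro h
    refine ⟨29 / 40, lennardJones, fun _ => 0, fun _ => 0, fun r _ => by ring, fun _ _ => le_rfl,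
      fun n y w => by simp, fun N x hx => ?_, by norm_num⟩
    exact h N x hx

/-- The crux implies its range-free form. [folklore] -/
theorem withoutRange_of_onePercentCertificate (h : OnePercentCertificate) : WithoutRange :=
  withoutRange_iff_stability.2 (stability_bound_of_onePercentCertificate h)

/-! ## Line `Sketch` (lead prover-line-stmt-AtomisticToContinuum-11958-0, PICKED 2026-08-16): the crux as ONE
local constant.  Proofs: tree file `Theorems/OnePercentCertificate/Negative/StubLocal.lean` (p114975). -/

section LineSketch

open Summit.AtomisticToContinuum.Crystallization.Theorems
open Summit.AtomisticToContinuum.Crystallization.Theorems.ThreeConeSplit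

/-- The line's only open stub `stub_local` (skeleton `Lines/Sketch.lean`): the finite-range part `gS` of the tree
split is `cS`-stable (`cS = 657987/10⁶`; close packings reach `−0.651259`, margin `0.006728`). -/
def StubLocal : Prop :=
  ∀ (N : ℕ) (x : Fin N → E3), Function.Injective x → -(cS * (N : ℝ)) ≤ interactionEnergy gS x

/-- The stub closes the crux (tree reduction, p112372). -/
theorem onePercentCertificate_of_stubLocal (h : StubLocal) : OnePercentCertificate :=
  OnePercentReduction.onePercentCertificate_of_local h

/-- Exact constant: `cS = 0.657987`. -/
theorem cS_eq : cS = 657987 / 1000000 := StubLocal.cS_eq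

/-- `StubLocal` with injectivity dropped. -/
def StubLocalWithoutInjective : Prop :=
  ∀ (N : ℕ) (x : Fin N → E3), -(cS * (N : ℝ)) ≤ interactionEnergy gS x

/-- **Injectivity is load-bearing** (junk model: `11` coincident points, `gS 0 = −fS 0`). [folklore] -/
theorem stubLocal_false_without_injective : ¬ StubLocalWithoutInjective :=
  StubLocal.false_without_injective

/-- The crux with the stability clause dropped. -/
def WithoutStability : Prop :=
  ∃ (c : ℝ) (g U f : ℝ → ℝ), (∀ r : ℝ, 0 < r → lennardJones r = g r + U r + f r) ∧
    (∀ r : ℝ, 0 < r → 0 ≤ U r) ∧ (∀ r : ℝ, 5 / 2 ≤ r → g r = 0) ∧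
    (∀ (n : ℕ) (y : Fin n → E3) (w : Fin n → ℝ), 0 ≤ ∑ i, ∑ j, w i * w j * f (dist (y i) (y j))) ∧
    c + f 0 / 2 ≤ 29 / 40

/-- **All hypotheses but stability hold simultaneously** for `(cS, gS, US, fS)`: with `withoutPosType_trivial`,
`withoutSlackSign_trivial`, `withoutRange_iff_stability` the load-bearing table is complete — stability of a
range-`5/2` part is the crux's entire content. [folklore] -/
theorem withoutStability_holds : WithoutStability := StubLocal.withoutStability

/-- ONE-CENTRE FORM OF THE STUB UNDER A HARD CORE `δ` (the plain star strategy): every particle of a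
`δ`-separated configuration has `gS`-site energy `≥ −2 cS`. -/
def HardCoreSiteBound (δ : ℝ) : Prop :=
  ∀ (N : ℕ) (x : Fin N → E3), Function.Injective x → (∀ i j, i ≠ j → δ ≤ dist (x i) (x j)) →
    ∀ i, -(2 * cS) ≤ siteEnergy gS x i

/-- The site bound sums to the stub on `δ`-separated configurations. [folklore] -/
theorem stubLocal_of_hardCoreSiteBound {δ : ℝ} (h : HardCoreSiteBound δ) (N : ℕ) (x : Fin N → E3)
    (hx : Function.Injective x) (hsep : ∀ i j, i ≠ j → δ ≤ dist (x i) (x j)) :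
    -(cS * (N : ℝ)) ≤ interactionEnergy gS x :=
  StubLocal.of_hardCoreSiteBound h N x hx hsep

/-- **The one-centre strategy is dead up to hard core `9/10`**: sixteen explicit points (rational Tammes-15 shell)
give a `9/10`-separated star with centre site energy `15·gS 1 ≤ −1.395 < −2cS`. [folklore] -/
theorem not_hardCoreSiteBound : ¬ HardCoreSiteBound (9 / 10) := StubLocal.not_hardCoreSiteBound

/-- … and for every smaller hard core. [folklore] -/
theorem not_hardCoreSiteBound_of_le {δ : ℝ} (hδ : δ ≤ 9 / 10) : ¬ HardCoreSiteBound δ :=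
  StubLocal.not_hardCoreSiteBound_of_le hδ

/-- **… and up to hard core `19/20 = 0.978·nn(hcp)`** (tree: `Negative/StubLocalHardCore.lean`): thirty-one
rational points — `14` at radius `51/50` (Tammes-14 directions), `8` at `79/50`, `8` at `17/10`, pairwise `≥ 0.9521` —
with centre site energy `14·gS(51/50) + 8·gS(79/50) + 8·gS(17/10) ≤ −1.3373 < −2cS` (margin `0.021`).  Numerically
the relaxation still fails at `δ = 0.965` (`≤ −1.3269`) and is satisfied only from `δ ≈ 0.97` on (`−1.3085`;
`−1.3079` at `0.9712 =` nn(hcp-optimal), margin `0.008`): a transfer-free one-centre certificate needs a hard core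
within `1 %` of the equilibrium distance. [folklore] -/
theorem not_hardCoreSiteBound_nineteen_twentieths : ¬ HardCoreSiteBound (19 / 20) :=
  StubLocal.not_hardCoreSiteBound_nineteen_twentieths

/-- … hence for every `δ ≤ 19/20`. [folklore] -/
theorem not_hardCoreSiteBound_of_le' {δ : ℝ} (hδ : δ ≤ 19 / 20) : ¬ HardCoreSiteBound δ :=
  StubLocal.not_hardCoreSiteBound_of_le_nineteen_twentieths hδ

end LineSketch

end Summit.AtomisticToContinuum.Crystallization.Cruxes.OnePercentCertificate.Disproof
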